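import Mathlib
import Literature.Probability.Percolation.DiagonalStripGenericSimplicity
import Literature.Probability.Percolation.DiagonalStripGroundStateCocycle
import Literature.Probability.Percolation.DiagonalStripGenericInversion
import HarnessLib

/-!
# Pinning the qKZ normalisation of the generic ground state (IP12 §3.4)

Topic `Literature/Probability/Percolation`. Ikhlef–Ponsaing (J. Stat. Phys. 149 (2012),
arXiv:1202.5476) §3.4 normalise the ground state `Ψ` of `t(w; z⃗)` "so that all the components are
Laurent polynomials with no common factor" and state that it then satisfies the boundary qKZ system
`Ř_i(z_i/z_{i+1}) Ψ = π_i Ψ`, `Ψ(…, 1/z_L) = Ψ` exactly. `DiagonalStripGroundStateQKZ.lean` /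
`DiagonalStripGroundStateCocycle.lean` give these relations UP TO SCALARS `c_i`, `d` with the
unitarity cocycles `c_i σ_i(c_i) = [q/x][qx]`, `d ι(d) = 1`. This file pins the scalars for a
PRIMITIVE polynomial representative `P` (which exists: `exists_ipTransferMatrixW_fixed_primitive`,
by minimising the total degree; `ℂ[X_0, X_1, …]` is a UFD):

* tools: the factor theorem `X_j - g ∣ f - f(X_j ↦ g)` (`X_sub_dvd_sub_aeval`), integrality of a
  fraction against a coprime family (`isInteger_of_forall_mul`, `PolyPrimitive.exists_eq_toRF`),
  the substitutions `substHom`, the sign flips `flipAlg`/`genFlip` and the evenness of `t` in every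
  rapidity (`genFlip_ipTransferMatrixW`), whence a definite parity of `P` in each variable
  (`primitive_fixed_parity`);
* `pin_core`: if `A P_Q - q B E_Q = C₀ σ_i(P_Q)` (`A = q² X_{i+1}² - X_i²`, `B = X_i² - X_{i+1}²`)
  with `C₀ σ_i(C₀) = A σ_i(A)` and the left side vanishing on `X_{i+1} = q X_i`, then `C₀ = σ_i(A)`:
  the vanishing and the parity give the two linear factors `X_{i+1} ∓ q X_i` of `σ_i A`, the cocycle
  leaves a constant of square one, and the diagonal `X_{i+1} = X_i` fixes the sign;
* `exchange_scalar_pinned`, `groundState_exchange_odd_exact`, `groundState_exchange_even_exact`: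
  hence `c_i = [q z_i/z_{i+1}]`, GIVEN the vanishing of the exchange numerator on the hyperplane
  `z_{i+1} = q z_i` (which is where the uniqueness of the ground state on the hyperplane — Lemma A of
  `DiagonalStripHyperplaneRecursion.lean` — enters; it is taken as a hypothesis `hvan` here and
  discharged in `DiagonalStripQKZExact.lean`);
* `groundState_reflect_top_zpow`: the top reflection scalar is `d = z_L^{2a}` (`d z_L^N` is a
  polynomial dividing a power of the prime `X_L`; the sign is fixed at `X_L = 1`, the parity by the
  flip `genFlip L`, which commutes with the inversion).

## References

* Y. Ikhlef, A. K. Ponsaing, *Finite-size left-passage probability in percolation*, J. Stat. Phys.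
  149 (2012) 10–36, arXiv:1202.5476, §3.4. [IkhlefPonsaing2012]
-/

namespace Literature.Probability.Percolation

open Finset Literature.Probability.LatticeModels Literature.Probability.LatticeModels.TemperleyLieb

/-! ### Division by `X_j - g` in a polynomial ring -/

section PolyDiv

open MvPolynomial

variable {R : Type*} [CommRing R] {σ : Type*} [DecidableEq σ]

/-- **`X_j - g` divides `f - f(X_j ↦ g)`.** [folklore] -/
theorem X_sub_dvd_sub_aeval (j : σ) (g f : MvPolynomial σ R) :
    (X j - g) ∣ f - aeval (R := R) (Function.update (fun k => (X k : MvPolynomial σ R)) j g) f := by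
  set v : σ → MvPolynomial σ R := Function.update (fun k => (X k : MvPolynomial σ R)) j g with hv
  induction f using MvPolynomial.induction_on with
  | C a => simp
  | add p q hp hq =>
    have : p + q - aeval (R := R) v (p + q) = (p - aeval (R := R) v p) + (q - aeval (R := R) v q) := by
      rw [map_add]; ring
    rw [this]; exact dvd_add hp hq
  | mul_X p k hp =>
    have hk : (X j - g) ∣ X k - aeval (R := R) v (X k) := by
      rw [aeval_X, hv, Function.update_apply]
      split_ifs with h
      · subst h; rfl
      · simp
    have : p * X k - aeval (R := R) v (p * X k) =
        (p - aeval (R := R) v p) * X k + aeval (R := R) v p * (X k - aeval (R := R) v (X k)) := by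
      rw [map_mul]; ring
    rw [this]
    exact dvd_add (dvd_mul_of_dvd_left hp _) (dvd_mul_of_dvd_right hk _)

/-- **Factor theorem**: if `f(X_j ↦ g) = 0` then `X_j - g ∣ f`. [folklore] -/
theorem X_sub_dvd_of_aeval_eq_zero {j : σ} {g f : MvPolynomial σ R}
    (h : aeval (R := R) (Function.update (fun k => (X k : MvPolynomial σ R)) j g) f = 0) : (X j - g) ∣ f := by
  have := X_sub_dvd_sub_aeval j g f
  rwa [h, sub_zero] at this

end PolyDiv

/-! ### Denominators against a family without common divisors -/

section Denominators

variable {A : Type*} [CommRing A] [IsDomain A] [UniqueFactorizationMonoid A]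
variable {K : Type*} [Field K] [Algebra A K] [IsFractionRing A K]

/-- **A fraction which becomes integral against every member of a coprime family is integral.**
[folklore] -/
theorem isInteger_of_forall_mul {ι : Type*} (a : ι → A) (hgcd : ∀ d : A, (∀ i, d ∣ a i) → IsUnit d)
    {x : K} (hx : ∀ i, IsLocalization.IsInteger A (x * algebraMap A K (a i))) :
    IsLocalization.IsInteger A x := by
  rw [← IsFractionRing.isUnit_den_iff (A := A)]
  refine hgcd _ fun i => ?_
  obtain ⟨v, hv⟩ := hx i
  -- `num · a_i = v · den`
  have hinj := IsFractionRing.injective A K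
  have hden : algebraMap A K (IsFractionRing.den A x : A) ≠ 0 :=
    IsFractionRing.to_map_ne_zero_of_mem_nonZeroDivisors (IsFractionRing.den A x).2
  have hxd : x * algebraMap A K (IsFractionRing.den A x : A) = algebraMap A K (IsFractionRing.num A x) :=
    (IsFractionRing.num_mul_den_eq_num_iff_eq' (A := A)).2 rfl
  have key : (IsFractionRing.den A x : A) * v = IsFractionRing.num A x * a i :=
    hinj (by rw [map_mul, map_mul, hv, ← hxd]; ring)
  exact (IsFractionRing.num_den_reduced A x).symm.dvd_of_dvd_mul_left ⟨v, key.symm⟩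

end Denominators

/-! ### Primitive polynomial vectors -/

section Primitive

open MvPolynomial

variable {K₀ : Type*} [Field K₀] {ι : Type*}

/-- A family of polynomials is *primitive* when its common divisors are units. [folklore] -/
def PolyPrimitive (P : ι → MvPolynomial ℕ K₀) : Prop := ∀ d : MvPolynomial ℕ K₀, (∀ i, d ∣ P i) → IsUnit d

/-- **A rational scalar which multiplies a primitive polynomial family into polynomials is a
polynomial.** [folklore] -/
theorem PolyPrimitive.exists_eq_toRF {P : ι → MvPolynomial ℕ K₀} (hP : PolyPrimitive P) {c : RapidityField K₀}
    (hc : ∀ i, ∃ N : MvPolynomial ℕ K₀, c * toRF K₀ (P i) = toRF K₀ N) : ∃ C₀ : MvPolynomial ℕ K₀, c = toRF K₀ C₀ := by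
  obtain ⟨C₀, hC₀⟩ := isInteger_of_forall_mul (K := RapidityField K₀) P hP (x := c)
    (fun i => by obtain ⟨N, hN⟩ := hc i; exact ⟨N, hN.symm⟩)
  exact ⟨C₀, hC₀.symm⟩

/-- Primitivity is invariant under a ring automorphism of the polynomial ring. [folklore] -/
theorem PolyPrimitive.map_equiv {P : ι → MvPolynomial ℕ K₀} (hP : PolyPrimitive P)
    (e : MvPolynomial ℕ K₀ ≃+* MvPolynomial ℕ K₀) : PolyPrimitive (fun i => e (P i)) := by
  intro d hd
  have : IsUnit (e.symm d) := hP _ fun i => by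
    obtain ⟨r, hr⟩ := hd i
    exact ⟨e.symm r, by rw [← map_mul, ← hr, RingEquiv.symm_apply_apply]⟩
  simpa using this.map e

/-- A primitive family is not identically zero (when the index type is nonempty). [folklore] -/
theorem PolyPrimitive.exists_ne_zero [Nonempty ι] {P : ι → MvPolynomial ℕ K₀} (hP : PolyPrimitive P) :
    ∃ i, P i ≠ 0 := by
  by_contra h
  push Not at h
  have := hP 0 fun i => by rw [h i]
  exact not_isUnit_zero this

/-- **No non-unit divides every member of a primitive family**; in particular no `X_j - g` with
`g` free of... — stated for an arbitrary non-unit. [folklore] -/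
theorem PolyPrimitive.not_forall_dvd {P : ι → MvPolynomial ℕ K₀} (hP : PolyPrimitive P) {d : MvPolynomial ℕ K₀}
    (hd : ¬ IsUnit d) : ¬ ∀ i, d ∣ P i := fun h => hd (hP d h)

/-- `X_j - C a * X_k` (`j ≠ k`) is not a unit. [folklore] -/
theorem not_isUnit_X_sub (j k : ℕ) (hjk : j ≠ k) (a : K₀) : ¬ IsUnit (X j - C a * X k : MvPolynomial ℕ K₀) := by
  classical
  intro h
  have := h.map (aeval (Function.update (fun i => (X i : MvPolynomial ℕ K₀)) k 0))
  rw [map_sub, map_mul, aeval_C, aeval_X, aeval_X, Function.update_of_ne hjk, Function.update_self,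
    mul_zero, sub_zero] at this
  exact (MvPolynomial.X_prime (R := K₀) (σ := ℕ) (i := j)).not_unit this

/-- `X_j - C a` is not a unit. [folklore] -/
theorem not_isUnit_X_sub_C (j : ℕ) (a : K₀) : ¬ IsUnit (X j - C a : MvPolynomial ℕ K₀) := by
  classical
  intro h
  have := h.map (aeval (Function.update (fun i => (X i : MvPolynomial ℕ K₀)) j (X j + C a)))
  rw [map_sub, aeval_C, aeval_X, Function.update_self, algebraMap_eq, add_sub_cancel_right] at this
  exact (MvPolynomial.X_prime (R := K₀) (σ := ℕ) (i := j)).not_unit this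

end Primitive

/-! ### A primitive polynomial ground state -/

section PrimitiveGroundState

open MvPolynomial

variable {m : ℕ}

/-- **The generic ground state has a primitive polynomial representative.**
[cite: IkhlefPonsaing2012, §3.4] -/
theorem exists_ipTransferMatrixW_fixed_primitive {q : ℂ} (hq : q ^ 2 + q + 1 = 0) :
    ∃ P : ColPattern m → MvPolynomial ℕ ℂ, PolyPrimitive P ∧
      ∀ Q', ∑ Q, ipTransferMatrixW m (genC ℂ q) (genW ℂ) (genZ ℂ) Q Q' * toRF ℂ (P Q) = toRF ℂ (P Q') := by
  classical
  -- minimise the total degree over all nonzero polynomial fixed vectors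
  let good : (ColPattern m → MvPolynomial ℕ ℂ) → Prop := fun P => P ≠ 0 ∧
    ∀ Q', ∑ Q, ipTransferMatrixW m (genC ℂ q) (genW ℂ) (genZ ℂ) Q Q' * toRF ℂ (P Q) = toRF ℂ (P Q')
  have hex : ∃ n, ∃ P, good P ∧ ∑ Q, (P Q).totalDegree = n := by
    obtain ⟨P, hP0, hP⟩ := exists_ipTransferMatrixW_fixed_polynomial (m := m) hq
    exact ⟨_, P, ⟨hP0, hP⟩, rfl⟩
  obtain ⟨P, ⟨hP0, hP⟩, hdeg⟩ := Nat.find_spec hex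
  have hmin : ∀ P', good P' → ∑ Q, (P Q).totalDegree ≤ ∑ Q, (P' Q).totalDegree := fun P' hP' => by
    rw [hdeg]; exact Nat.find_min' hex ⟨P', hP', rfl⟩
  refine ⟨P, fun d hd => ?_, hP⟩
  by_contra hdu
  -- divide by `d`
  choose R hR using hd
  have hd0 : d ≠ 0 := by
    rintro rfl
    apply hP0; funext Q; rw [hR Q, zero_mul]; rfl
  have hgood : good R := by
    refine ⟨fun h => hP0 (funext fun Q => by rw [hR Q, congrFun h Q, Pi.zero_apply, mul_zero]), fun Q' => ?_⟩
    have hdRF : toRF ℂ d ≠ 0 := fun h => hd0 (toRF_injective (by rw [h, map_zero]))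
    have := hP Q'
    simp only [hR, map_mul] at this
    apply mul_left_cancel₀ hdRF
    rw [← this, Finset.mul_sum]
    exact Finset.sum_congr rfl fun Q _ => by ring
  have hlt : ∑ Q, (R Q).totalDegree < ∑ Q, (P Q).totalDegree := by
    have hdpos : 0 < d.totalDegree := by
      rw [MvPolynomial.isUnit_iff_totalDegree_of_isReduced] at hdu
      push Not at hdu
      by_contra h0
      push Not at h0
      have h0' : d.totalDegree = 0 := Nat.le_zero.1 h0
      refine hdu ?_ h0'
      rw [totalDegree_eq_zero_iff_eq_C] at h0'
      rw [h0'] at hd0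
      have : coeff 0 d ≠ 0 := fun h => hd0 (by rw [h, map_zero])
      exact isUnit_iff_ne_zero.2 this
    obtain ⟨Q₀, hQ₀⟩ : ∃ Q₀, R Q₀ ≠ 0 := by
      by_contra h; push Not at h
      exact hgood.1 (funext h)
    apply Finset.sum_lt_sum
    · intro Q _
      by_cases hRQ : R Q = 0
      · rw [hRQ, totalDegree_zero]; exact Nat.zero_le _
      · rw [hR Q, totalDegree_mul_of_isDomain hd0 hRQ]; omega
    · exact ⟨Q₀, Finset.mem_univ _, by rw [hR Q₀, totalDegree_mul_of_isDomain hd0 hQ₀]; omega⟩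
  exact absurd (hmin R hgood) (not_le.2 hlt)

end PrimitiveGroundState

/-! ### Substitution endomorphisms of the polynomial ring -/

section Subst

open MvPolynomial

variable {K₀ : Type*} [Field K₀]

/-- The substitution `X_k ↦ g` (other variables fixed). [folklore] -/
noncomputable def substHom (k : ℕ) (g : MvPolynomial ℕ K₀) : MvPolynomial ℕ K₀ →ₐ[K₀] MvPolynomial ℕ K₀ :=
  aeval (R := K₀) (Function.update (fun n => (X n : MvPolynomial ℕ K₀)) k g)

/-- `substHom` on the substituted variable. [folklore] -/
@[simp] theorem substHom_X_self (k : ℕ) (g : MvPolynomial ℕ K₀) : substHom k g (X k) = g := by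
  classical
  simp [substHom]

/-- `substHom` on the other variables. [folklore] -/
theorem substHom_X_of_ne {k n : ℕ} (g : MvPolynomial ℕ K₀) (h : n ≠ k) : substHom k g (X n) = X n := by
  classical
  simp [substHom, Function.update_of_ne h]

/-- `substHom` on constants. [folklore] -/
@[simp] theorem substHom_C (k : ℕ) (g : MvPolynomial ℕ K₀) (a : K₀) : substHom k g (C a) = C a := by
  simp [substHom]

/-- **Factor theorem for `substHom`.** [folklore] -/
theorem X_sub_dvd_of_substHom_eq_zero {k : ℕ} {g f : MvPolynomial ℕ K₀} (h : substHom k g f = 0) :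
    (X k - g) ∣ f := by
  classical
  exact X_sub_dvd_of_aeval_eq_zero (by simpa [substHom] using h)

/-- The sign flip `X_k ↦ -X_k` is an involution. [folklore] -/
theorem substHom_neg_substHom_neg (k : ℕ) (f : MvPolynomial ℕ K₀) :
    substHom k (-X k) (substHom k (-X k) f) = f := by
  have : (substHom k (-X k)).comp (substHom k (-X k)) = AlgHom.id K₀ (MvPolynomial ℕ K₀) := by
    refine algHom_ext fun n => ?_
    by_cases h : n = k
    · subst h; simp
    · simp [substHom_X_of_ne _ h]
  exact congrArg (fun φ : MvPolynomial ℕ K₀ →ₐ[K₀] MvPolynomial ℕ K₀ => φ f) this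

variable (K₀) in
/-- The sign flip `X_k ↦ -X_k` as an algebra automorphism. [folklore] -/
noncomputable def flipAlg (k : ℕ) : MvPolynomial ℕ K₀ ≃ₐ[K₀] MvPolynomial ℕ K₀ :=
  AlgEquiv.ofAlgHom (substHom k (-X k)) (substHom k (-X k))
    (by ext1 n; exact substHom_neg_substHom_neg k (X n)) (by ext1 n; exact substHom_neg_substHom_neg k (X n))

/-- `flipAlg` is the substitution. [folklore] -/
theorem flipAlg_apply (k : ℕ) (f : MvPolynomial ℕ K₀) : flipAlg K₀ k f = substHom k (-X k) f := rfl

variable (K₀) in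
/-- The sign flip `z_k ↦ -z_k` of the rapidity field. [folklore] -/
noncomputable def genFlip (k : ℕ) : RapidityField K₀ ≃+* RapidityField K₀ :=
  IsFractionRing.ringEquivOfRingEquiv (flipAlg K₀ k).toRingEquiv

/-- `genFlip` on polynomials. [folklore] -/
theorem genFlip_toRF (k : ℕ) (f : MvPolynomial ℕ K₀) : genFlip K₀ k (toRF K₀ f) = toRF K₀ (substHom k (-X k) f) :=
  IsFractionRing.ringEquivOfRingEquiv_algebraMap _ f

/-- `genFlip` on the rapidities. [folklore] -/
theorem genFlip_genZ (k n : ℕ) : genFlip K₀ k (genZ K₀ n) = if n = k then -genZ K₀ k else genZ K₀ n := by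
  rw [show genZ K₀ n = toRF K₀ (X n) from rfl, genFlip_toRF]
  split_ifs with h
  · subst h; rw [substHom_X_self, map_neg]; rfl
  · rw [substHom_X_of_ne _ h]

/-- `genFlip` on constants. [folklore] -/
theorem genFlip_genC (k : ℕ) (q : K₀) : genFlip K₀ k (genC K₀ q) = genC K₀ q := by
  rw [show genC K₀ q = toRF K₀ (C q) from rfl, genFlip_toRF, substHom_C]

/-- `genFlip` is an involution. [folklore] -/
theorem genFlip_genFlip (k : ℕ) (x : RapidityField K₀) : genFlip K₀ k (genFlip K₀ k x) = x := by
  obtain ⟨a, b, hb, rfl⟩ := IsFractionRing.div_surjective (A := MvPolynomial ℕ K₀) x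
  rw [map_div₀, map_div₀, genFlip_toRF, genFlip_toRF, genFlip_toRF, genFlip_toRF,
    substHom_neg_substHom_neg, substHom_neg_substHom_neg]

end Subst

/-! ### The transfer matrix is even in every rapidity and in `w` -/

section Even

variable {K : Type*} [Field K] {m : ℕ}

/-- `[−x] = −[x]`. [folklore] -/
theorem qbr_neg (x : K) : qbr (-x) = -qbr x := by unfold qbr; rw [inv_neg]; ring

/-- `A(−x) = A(x)`. [folklore] -/
theorem ipWtA_neg (q x : K) : ipWtA q (-x) = ipWtA q x := by
  unfold ipWtA; rw [mul_neg, div_neg, qbr_neg, qbr_neg, neg_div_neg_eq]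

/-- `B(−x) = B(x)`. [folklore] -/
theorem ipWtB_neg (q x : K) : ipWtB q (-x) = ipWtB q x := by
  unfold ipWtB; rw [div_neg, qbr_neg, qbr_neg, neg_div_neg_eq]

/-- **The row weights are even in `z_k` (`k ≥ 1`… any `k`).** [folklore] -/
theorem ipRowWeight_update_neg (q w : K) (z : ℕ → K) (k : ℕ) :
    ipRowWeight q w (Function.update z k (-z k)) = ipRowWeight q w z := by
  funext r e
  unfold ipRowWeight
  by_cases hk : (edgeTopLevel e).toNat = k
  · rw [hk, Function.update_self]
    split_ifs <;> first
      | rw [neg_div, ipWtA_neg] | rw [neg_div, ipWtB_neg] | rw [mul_neg, inv_neg, ipWtA_neg]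
      | rw [mul_neg, inv_neg, ipWtB_neg]
  · rw [Function.update_of_ne hk]

/-- **The row weights are even in `(w, z_0)` jointly** (and `z_0` is never used). [folklore] -/
theorem ipRowWeight_neg_w (q w : K) (z : ℕ → K) :
    ipRowWeight q (-w) (Function.update z 0 (-z 0)) = ipRowWeight q w z := by
  funext r e
  unfold ipRowWeight
  by_cases hk : (edgeTopLevel e).toNat = 0
  · rw [hk, Function.update_self]
    simp only [neg_div_neg_eq, neg_mul_neg]
  · rw [Function.update_of_ne hk]
    split_ifs <;> first
      | rw [div_neg, ipWtA_neg] | rw [div_neg, ipWtB_neg] | rw [neg_mul, inv_neg, ipWtA_neg]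
      | rw [neg_mul, inv_neg, ipWtB_neg]

/-- **`t(w; z⃗)` is even in each `z_k`.** [folklore] -/
theorem ipTransferMatrixW_update_neg (q w : K) (z : ℕ → K) (k : ℕ) (Q Q' : ColPattern m) :
    ipTransferMatrixW m q w (Function.update z k (-z k)) Q Q' = ipTransferMatrixW m q w z Q Q' := by
  rw [ipTransferMatrixW_eq, ipTransferMatrixW_eq, ipRowWeight_update_neg]

/-- **`t(w; z⃗)` is even in `w`** (jointly with the unused `z_0`). [folklore] -/
theorem ipTransferMatrixW_neg_w (q w : K) (z : ℕ → K) (Q Q' : ColPattern m) :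
    ipTransferMatrixW m q (-w) (Function.update z 0 (-z 0)) Q Q' = ipTransferMatrixW m q w z Q Q' := by
  rw [ipTransferMatrixW_eq, ipTransferMatrixW_eq, ipRowWeight_neg_w]

variable {K₀ : Type*} [Field K₀]

/-- **The generic transfer matrix is invariant under every sign flip `genFlip k`.** [folklore] -/
theorem genFlip_ipTransferMatrixW (k : ℕ) (q : K₀) (Q Q' : ColPattern m) :
    genFlip K₀ k (ipTransferMatrixW m (genC K₀ q) (genW K₀) (genZ K₀) Q Q') =
      ipTransferMatrixW m (genC K₀ q) (genW K₀) (genZ K₀) Q Q' := by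
  rw [show (genFlip K₀ k : RapidityField K₀ → RapidityField K₀) = (genFlip K₀ k).toRingHom from rfl,
    map_ipTransferMatrixW]
  simp only [RingEquiv.toRingHom_eq_coe, RingEquiv.coe_toRingHom, genFlip_genC]
  have hz : (genFlip K₀ k) ∘ genZ K₀ = Function.update (genZ K₀) k (-genZ K₀ k) := by
    funext n
    rw [Function.comp_apply, genFlip_genZ, Function.update_apply]
  rw [hz]
  by_cases hk : k = 0
  · subst hk
    rw [show genW K₀ = genZ K₀ 0 from rfl, show (genFlip K₀ 0 : RapidityField K₀ ≃+* _) (genZ K₀ 0) = -genZ K₀ 0 by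
      rw [genFlip_genZ, if_pos rfl], ipTransferMatrixW_neg_w]
  · rw [show (genFlip K₀ k : RapidityField K₀ ≃+* _) (genW K₀) = genW K₀ by
      rw [show genW K₀ = genZ K₀ 0 from rfl, genFlip_genZ, if_neg (Ne.symm hk)], ipTransferMatrixW_update_neg]

/-- A flipped fixed vector is fixed. [folklore] -/
theorem fixed_genFlip (k : ℕ) {q : K₀} {ψ : ColPattern m → RapidityField K₀}
    (hψ : ∀ Q', ∑ Q, ipTransferMatrixW m (genC K₀ q) (genW K₀) (genZ K₀) Q Q' * ψ Q = ψ Q') :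
    ∀ Q', ∑ Q, ipTransferMatrixW m (genC K₀ q) (genW K₀) (genZ K₀) Q Q' * genFlip K₀ k (ψ Q) = genFlip K₀ k (ψ Q') := by
  intro Q'
  rw [← hψ Q', map_sum]
  refine Finset.sum_congr rfl fun Q _ => ?_
  rw [map_mul, genFlip_ipTransferMatrixW]

end Even

/-! ### Parity of a primitive polynomial ground state -/

section Parity

open MvPolynomial

variable {m : ℕ}

/-- **Every primitive polynomial ground state has a definite parity in each variable**:
`P(…, -z_k, …) = ε_k P` with `ε_k = ±1`. [folklore] -/
theorem primitive_fixed_parity {q : ℂ} (hq : q ^ 2 + q + 1 = 0) {P : ColPattern m → MvPolynomial ℕ ℂ}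
    (hprim : PolyPrimitive P)
    (hP : ∀ Q', ∑ Q, ipTransferMatrixW m (genC ℂ q) (genW ℂ) (genZ ℂ) Q Q' * toRF ℂ (P Q) = toRF ℂ (P Q')) (k : ℕ) :
    ∃ ε : ℂ, ε ^ 2 = 1 ∧ ∀ Q, substHom k (-X k) (P Q) = C ε * P Q := by
  classical
  have hP0 : (fun Q => toRF ℂ (P Q)) ≠ 0 := by
    obtain ⟨Q₀, hQ₀⟩ := hprim.exists_ne_zero
    intro h
    exact hQ₀ (toRF_injective ((congrFun h Q₀).trans (map_zero _).symm))
  have hflip := fixed_genFlip k hP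
  obtain ⟨c, hc⟩ := exists_scalar_of_proportional
    (fun k' => ipTransferMatrixW_fixed_proportional hq hP hflip k') hP0
  -- `c` is a polynomial
  simp only [genFlip_toRF] at hc
  obtain ⟨C₀, rfl⟩ := hprim.exists_eq_toRF (c := c) fun Q => ⟨_, (hc Q).symm⟩
  -- and its flip times itself is `1`
  obtain ⟨Q₀, hQ₀⟩ := hprim.exists_ne_zero
  have hsq : substHom k (-X k) C₀ * C₀ = 1 := by
    have h1 := hc Q₀
    have h2 : toRF ℂ (P Q₀) = toRF ℂ (substHom k (-X k) C₀) * toRF ℂ (substHom k (-X k) (P Q₀)) := by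
      have := congrArg (genFlip ℂ k) h1
      rw [genFlip_toRF, substHom_neg_substHom_neg, map_mul, genFlip_toRF, genFlip_toRF] at this
      exact this
    rw [h1, ← mul_assoc, ← map_mul, ← map_mul] at h2
    have h3 : toRF ℂ ((substHom k (-X k) C₀ * C₀ - 1) * P Q₀) = 0 := by
      rw [sub_mul, one_mul, map_sub, ← h2, sub_self]
    have h4 := toRF_injective (h3.trans (map_zero _).symm)
    rcases mul_eq_zero.1 h4 with h | h
    · exact sub_eq_zero.1 h
    · exact absurd h hQ₀
  have hunit : IsUnit C₀ := IsUnit.of_mul_eq_one_right _ hsq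
  rw [MvPolynomial.isUnit_iff_eq_C_of_isReduced] at hunit
  obtain ⟨ε, -, rfl⟩ := hunit
  refine ⟨ε, ?_, fun Q => toRF_injective (by rw [map_mul]; exact hc Q)⟩
  rw [substHom_C, ← map_mul, ← C_1] at hsq
  have := C_injective ℕ ℂ hsq
  rw [← this]; ring

end Parity

/-! ### The algebraic core of the pinning argument -/

section PinCore

open MvPolynomial

variable {K₀ : Type*} [Field K₀] {ι : Type*} [Nonempty ι]

/-- `rename (swap i (i+1))` is an involution. [folklore] -/
theorem rename_swap_rename_swap (i : ℕ) (f : MvPolynomial ℕ K₀) :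
    rename (Equiv.swap i (i + 1)) (rename (Equiv.swap i (i + 1)) f) = f := by
  rw [rename_rename, show (Equiv.swap i (i + 1)) ∘ (Equiv.swap i (i + 1)) = id from
    funext fun n => Equiv.swap_apply_self _ _ _, rename_id]; rfl

/-- Divisibility transported through the swap. [folklore] -/
theorem dvd_of_rename_swap_dvd {i : ℕ} {d f : MvPolynomial ℕ K₀} (h : d ∣ rename (Equiv.swap i (i + 1)) f) :
    rename (Equiv.swap i (i + 1)) d ∣ f := by
  obtain ⟨r, hr⟩ := h
  refine ⟨rename (Equiv.swap i (i + 1)) r, ?_⟩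
  rw [← map_mul, ← hr, rename_swap_rename_swap]

/-- **Core of the pinning of the exchange scalar.** In `K₀[X]` let `A = q² X_{i+1}² - X_i²`,
`B = X_i² - X_{i+1}²`, `Aσ = q² X_i² - X_{i+1}²` (`= σ_i A`). Suppose a primitive family `P` with
definite parities `ε_i, ε_{i+1}` in `X_i, X_{i+1}`, a family `E` with parity `ε_{i+1}` in `X_{i+1}`,
and a polynomial `C₀` satisfy `A P_Q - q B E_Q = C₀ σ_i(P_Q)` for all `Q`, the left side vanishing
under `X_{i+1} ↦ q X_i`, and the cocycle identity `C₀ σ_i(C₀) = A Aσ`. Then (`q ≠ 0`, `q² ≠ 1`,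
`2 ≠ 0`) `C₀ = Aσ`. [cite: IkhlefPonsaing2012, §3.4] -/
theorem pin_core (h2 : (2 : K₀) ≠ 0) {q : K₀} (hq0 : q ≠ 0) (hq1 : q ^ 2 ≠ 1) (i : ℕ)
    {P E : ι → MvPolynomial ℕ K₀} (hprim : PolyPrimitive P)
    {εi εi1 : K₀} (hεi : εi ^ 2 = 1) (hPi : ∀ Q, substHom i (-X i) (P Q) = C εi * P Q)
    (hPi1 : ∀ Q, substHom (i + 1) (-X (i + 1)) (P Q) = C εi1 * P Q)
    (hE : ∀ Q, substHom (i + 1) (-X (i + 1)) (E Q) = C εi1 * E Q) {C₀ : MvPolynomial ℕ K₀}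
    (hid : ∀ Q, (C (q ^ 2) * X (i + 1) ^ 2 - X i ^ 2) * P Q - C q * (X i ^ 2 - X (i + 1) ^ 2) * E Q =
      C₀ * rename (Equiv.swap i (i + 1)) (P Q))
    (hvan : ∀ Q, substHom (i + 1) (C q * X i)
      ((C (q ^ 2) * X (i + 1) ^ 2 - X i ^ 2) * P Q - C q * (X i ^ 2 - X (i + 1) ^ 2) * E Q) = 0)
    (hcoc : C₀ * rename (Equiv.swap i (i + 1)) C₀ =
      (C (q ^ 2) * X (i + 1) ^ 2 - X i ^ 2) * (C (q ^ 2) * X i ^ 2 - X (i + 1) ^ 2)) :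
    C₀ = C (q ^ 2) * X i ^ 2 - X (i + 1) ^ 2 := by
  classical
  have hii : i ≠ i + 1 := by omega
  set A : MvPolynomial ℕ K₀ := C (q ^ 2) * X (i + 1) ^ 2 - X i ^ 2 with hA
  set B : MvPolynomial ℕ K₀ := X i ^ 2 - X (i + 1) ^ 2 with hB
  set Aσ : MvPolynomial ℕ K₀ := C (q ^ 2) * X i ^ 2 - X (i + 1) ^ 2 with hAσ
  set σ : MvPolynomial ℕ K₀ →ₐ[K₀] MvPolynomial ℕ K₀ := rename (Equiv.swap i (i + 1)) with hσ
  set η := substHom (K₀ := K₀) (i + 1) (C q * X i) with hη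
  set ηm := substHom (K₀ := K₀) (i + 1) (-(C q * X i)) with hηm
  set φ := substHom (K₀ := K₀) (i + 1) (-X (i + 1)) with hφ
  set φ' := substHom (K₀ := K₀) i (-X i) with hφ'
  -- basic values
  have hσXi : σ (X i) = X (i + 1) := by rw [hσ, rename_X, Equiv.swap_apply_left]
  have hσXi1 : σ (X (i + 1)) = X i := by rw [hσ, rename_X, Equiv.swap_apply_right]
  have hA0 : A ≠ 0 := by
    intro h
    have := congrArg (eval fun n => if n = i then (1 : K₀) else 0) h
    simp [hA] at this
  have hAσ0 : Aσ ≠ 0 := by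
    intro h
    have := congrArg (eval fun n => if n = i + 1 then (1 : K₀) else 0) h
    simp [hAσ] at this
  obtain ⟨Q₀, hQ₀⟩ := hprim.exists_ne_zero
  have hσP0 : σ (P Q₀) ≠ 0 := fun h => hQ₀ (by
    have := congrArg σ h; rwa [hσ, rename_swap_rename_swap, map_zero] at this)
  -- S3: `η C₀ = 0`
  have hηC : η C₀ = 0 := by
    by_contra hne
    have hall : ∀ Q, η (σ (P Q)) = 0 := fun Q => by
      have := congrArg η (hid Q)
      rw [hvan Q, map_mul] at this
      exact (mul_eq_zero.1 this.symm).resolve_left hne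
    refine not_isUnit_X_sub i (i + 1) hii q (hprim _ fun Q => ?_)
    have h1 : (X (i + 1) - C q * X i) ∣ σ (P Q) := X_sub_dvd_of_substHom_eq_zero (hall Q)
    have h2 := dvd_of_rename_swap_dvd h1
    rwa [map_sub, map_mul, rename_C, rename_X, rename_X, Equiv.swap_apply_right, Equiv.swap_apply_left] at h2
  -- S4: parity of `C₀` in `X_{i+1}`
  have hφA : φ A = A := by
    simp only [hφ, hA, map_sub, map_mul, map_pow, substHom_C, substHom_X_self, substHom_X_of_ne _ hii]; ring
  have hφB : φ B = B := by
    simp only [hφ, hB, map_sub, map_pow, substHom_X_self, substHom_X_of_ne _ hii]; ring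
  have hφXi : φ (X i) = X i := by rw [hφ, substHom_X_of_ne _ hii]
  have hφXi1 : φ (X (i + 1)) = -X (i + 1) := by rw [hφ, substHom_X_self]
  have hφ'Xi : φ' (X i) = -X i := by rw [hφ', substHom_X_self]
  have hφ'Xi1 : φ' (X (i + 1)) = X (i + 1) := by rw [hφ', substHom_X_of_ne _ (Ne.symm hii)]
  have hφσ : ∀ f, φ (σ f) = σ (φ' f) := by
    intro f
    have : φ.comp σ = σ.comp φ' := by
      refine algHom_ext fun n => ?_
      simp only [AlgHom.comp_apply]
      by_cases hn : n = i
      · rw [hn, hσXi, hφXi1, hφ'Xi, map_neg, hσXi]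
      · by_cases hn' : n = i + 1
        · rw [hn', hσXi1, hφXi, hφ'Xi1, hσXi1]
        · have h1 : σ (X n) = X n := by rw [hσ, rename_X, Equiv.swap_apply_of_ne_of_ne hn hn']
          have h2 : φ (X n) = X n := by rw [hφ, substHom_X_of_ne _ hn']
          have h3 : φ' (X n) = X n := by rw [hφ', substHom_X_of_ne _ hn]
          rw [h1, h2, h3, h1]
    exact congrArg (fun ψ : MvPolynomial ℕ K₀ →ₐ[K₀] MvPolynomial ℕ K₀ => ψ f) this
  have hφC : φ C₀ = C (εi1 * εi) * C₀ := by
    have h1 := congrArg φ (hid Q₀)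
    rw [map_sub, map_mul, map_mul, map_mul, map_mul, hφA, hφB, substHom_C, hPi1, hE, hφσ, hPi, map_mul,
      rename_C] at h1
    -- h1 : A * (C εi1 * P Q₀) - C q * B * (C εi1 * E Q₀) = φ C₀ * (C εi * σ (P Q₀))
    have h2 : C εi1 * (A * P Q₀ - C q * B * E Q₀) = φ C₀ * (C εi * σ (P Q₀)) := by rw [← h1]; ring
    rw [hid Q₀] at h2
    -- `C εi1 * C₀ * σP = φ C₀ * C εi * σP`
    have h3 : (C εi1 * C₀ - C εi * φ C₀) * σ (P Q₀) = 0 := by linear_combination h2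
    have h4 : C εi1 * C₀ = C εi * φ C₀ := sub_eq_zero.1 ((mul_eq_zero.1 h3).resolve_right hσP0)
    have h5 := congrArg (fun f => C εi * f) h4
    rw [← mul_assoc, ← mul_assoc, ← map_mul, ← map_mul, ← sq, hεi, C_1, one_mul] at h5
    rw [← h5, mul_comm εi1 εi]
  -- hence `ηm C₀ = 0`
  have hηφ : ∀ f, η (φ f) = ηm f := by
    intro f
    have : η.comp φ = ηm := by
      refine algHom_ext fun n => ?_
      simp only [AlgHom.comp_apply]
      by_cases hn : n = i + 1
      · have h1 : η (X (i + 1)) = C q * X i := by rw [hη, substHom_X_self]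
        have h2 : ηm (X (i + 1)) = -(C q * X i) := by rw [hηm, substHom_X_self]
        rw [hn, hφXi1, map_neg, h1, h2]
      · have h1 : η (X n) = X n := by rw [hη, substHom_X_of_ne _ hn]
        have h2 : ηm (X n) = X n := by rw [hηm, substHom_X_of_ne _ hn]
        have h3 : φ (X n) = X n := by rw [hφ, substHom_X_of_ne _ hn]
        rw [h3, h1, h2]
    exact congrArg (fun ψ : MvPolynomial ℕ K₀ →ₐ[K₀] MvPolynomial ℕ K₀ => ψ f) this
  have hηmC : ηm C₀ = 0 := by
    rw [← hηφ, hφC, map_mul, substHom_C, hηC, mul_zero]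
  -- S5: the two linear factors
  obtain ⟨C₁, hC₁⟩ : (X (i + 1) - C q * X i) ∣ C₀ := X_sub_dvd_of_substHom_eq_zero hηC
  have hηmC₁ : ηm C₁ = 0 := by
    have := hηmC
    have h1 : ηm (X (i + 1)) = -(C q * X i) := by rw [hηm, substHom_X_self]
    have h2' : ηm (X i) = X i := by rw [hηm, substHom_X_of_ne _ hii]
    rw [hC₁, map_mul, map_sub, map_mul, substHom_C, h1, h2'] at this
    refine (mul_eq_zero.1 this).resolve_left ?_
    rw [show -(C q * X i) - C q * X i = C (-(2 * q)) * (X i : MvPolynomial ℕ K₀) by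
      rw [map_neg, map_mul, map_ofNat]; ring]
    exact mul_ne_zero (by rw [Ne, C_eq_zero, neg_eq_zero]; exact mul_ne_zero h2 hq0) (X_ne_zero _)
  obtain ⟨C₂, hC₂⟩ : (X (i + 1) - -(C q * X i)) ∣ C₁ := X_sub_dvd_of_substHom_eq_zero hηmC₁
  have hC₀ : C₀ = -Aσ * C₂ := by rw [hC₁, hC₂, hAσ, map_pow]; ring
  -- S6: the cocycle pins `C₂` to a constant of square `1`
  have hσAσ : σ Aσ = A := by
    simp only [hσ, hAσ, hA, map_sub, map_mul, map_pow, rename_C, rename_X, Equiv.swap_apply_left,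
      Equiv.swap_apply_right]
  have hunit : C₂ * σ C₂ = 1 := by
    have := hcoc
    rw [hC₀, map_mul, map_neg, hσAσ] at this
    have h' : A * Aσ * (C₂ * σ C₂ - 1) = 0 := by linear_combination this
    exact sub_eq_zero.1 ((mul_eq_zero.1 h').resolve_left (mul_ne_zero hA0 hAσ0))
  obtain ⟨u, -, hu⟩ := (MvPolynomial.isUnit_iff_eq_C_of_isReduced).1 (IsUnit.of_mul_eq_one _ hunit)
  have hu2 : u ^ 2 = 1 := by
    rw [hu, hσ, rename_C, ← map_mul, ← C_1] at hunit
    have := C_injective ℕ K₀ hunit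
    rw [← this]; ring
  -- S7: the sign, by the diagonal substitution `X_{i+1} ↦ X_i`
  set Δ := substHom (K₀ := K₀) (i + 1) (X i) with hΔ
  have hΔXi : Δ (X i) = X i := by rw [hΔ, substHom_X_of_ne _ hii]
  have hΔXi1 : Δ (X (i + 1)) = X i := by rw [hΔ, substHom_X_self]
  have hΔσ : ∀ f, Δ (σ f) = Δ f := by
    intro f
    have : Δ.comp σ = Δ := by
      refine algHom_ext fun n => ?_
      simp only [AlgHom.comp_apply]
      by_cases hn : n = i
      · rw [hn, hσXi, hΔXi1, hΔXi]
      · by_cases hn' : n = i + 1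
        · rw [hn', hσXi1, hΔXi, hΔXi1]
        · rw [hσ, rename_X, Equiv.swap_apply_of_ne_of_ne hn hn']
    exact congrArg (fun ψ : MvPolynomial ℕ K₀ →ₐ[K₀] MvPolynomial ℕ K₀ => ψ f) this
  have hΔA : Δ A = (C (q ^ 2) - 1) * X i ^ 2 := by
    rw [hA, map_sub, map_mul, substHom_C, map_pow Δ (X (i + 1)), map_pow Δ (X i), hΔXi, hΔXi1]; ring
  have hΔB : Δ B = 0 := by rw [hB, map_sub, map_pow Δ (X (i + 1)), map_pow Δ (X i), hΔXi, hΔXi1, sub_self]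
  have hΔAσ : Δ Aσ = (C (q ^ 2) - 1) * X i ^ 2 := by
    rw [hAσ, map_sub, map_mul, substHom_C, map_pow Δ (X (i + 1)), map_pow Δ (X i), hΔXi, hΔXi1]; ring
  have hsign : -u = 1 := by
    by_contra hne
    refine not_isUnit_X_sub (i + 1) i (Ne.symm hii) 1 (hprim _ fun Q => ?_)
    rw [C_1, one_mul]
    apply X_sub_dvd_of_substHom_eq_zero
    have h1 := congrArg Δ (hid Q)
    rw [hC₀, hu, map_sub, map_mul, map_mul, map_mul, map_mul, map_mul, map_neg, hΔσ, hΔA, hΔB, hΔAσ,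
      substHom_C, substHom_C] at h1
    -- h1 : (C q² - 1) X_i² ΔP - C q * 0 * ΔE = -((C q² - 1) X_i²) * C u * ΔP
    have h2 : (C (q ^ 2) - 1) * (1 + C u) * X i ^ 2 * Δ (P Q) = 0 := by linear_combination h1
    rw [← hΔ]
    refine (mul_eq_zero.1 h2).resolve_left (mul_ne_zero (mul_ne_zero ?_ ?_) (pow_ne_zero _ (X_ne_zero _)))
    · rw [← C_1, ← map_sub, Ne, C_eq_zero, sub_eq_zero]; exact hq1
    · rw [← C_1, ← map_add, Ne, C_eq_zero]
      intro h; exact hne (by linear_combination -h)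
  rw [hC₀, hu, show -Aσ * C u = C (-u) * Aσ by rw [map_neg]; ring, hsign, C_1, one_mul]

end PinCore

/-! ### Pinning the exchange scalars of a primitive polynomial ground state -/

section ExchangePinning

open MvPolynomial

variable {m : ℕ}

/-- `q² ≠ 1` at a primitive cube root of unity. [folklore] -/
theorem sq_ne_one_of_quad {K : Type*} [Field K] {q : K} (hq : q ^ 2 + q + 1 = 0) (h3 : (3 : K) ≠ 0) : q ^ 2 ≠ 1 := by
  intro h
  have hq' : q = -2 := by linear_combination hq - h
  rw [hq'] at h
  apply h3; linear_combination h

/-- The bracket `[q z_{i+1}/z_i]` cleared of denominators. [folklore] -/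
theorem qbr_mul_clear₁ {q : ℂ} (hq0 : q ≠ 0) (i : ℕ) :
    qbr (genC ℂ q * genZ ℂ (i + 1) / genZ ℂ i) * (genC ℂ q * genZ ℂ i * genZ ℂ (i + 1)) =
      toRF ℂ (C (q ^ 2) * X (i + 1) ^ 2 - X i ^ 2) := by
  have hz := genZ_ne_zero (K₀ := ℂ) i
  have hz' := genZ_ne_zero (K₀ := ℂ) (i + 1)
  unfold qbr
  simp only [map_sub, map_mul, map_pow]
  change _ = genC ℂ q ^ 2 * genZ ℂ (i + 1) ^ 2 - genZ ℂ i ^ 2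
  have hq : genC ℂ q ≠ 0 := toRF_ne_zero_of_eval (fun _ => 1) (by simp [hq0])
  field_simp

/-- The bracket `[z_i/z_{i+1}]` cleared of denominators. [folklore] -/
theorem qbr_mul_clear₂ (q : ℂ) (i : ℕ) :
    qbr (genZ ℂ i / genZ ℂ (i + 1)) * (genC ℂ q * genZ ℂ i * genZ ℂ (i + 1)) =
      toRF ℂ (C q * (X i ^ 2 - X (i + 1) ^ 2)) := by
  have hz := genZ_ne_zero (K₀ := ℂ) i
  have hz' := genZ_ne_zero (K₀ := ℂ) (i + 1)
  unfold qbr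
  simp only [map_sub, map_mul, map_pow]
  change _ = genC ℂ q * (genZ ℂ i ^ 2 - genZ ℂ (i + 1) ^ 2)
  field_simp

/-- The bracket `[q z_i/z_{i+1}]` cleared of denominators. [folklore] -/
theorem qbr_mul_clear₃ {q : ℂ} (hq0 : q ≠ 0) (i : ℕ) :
    qbr (genC ℂ q * genZ ℂ i / genZ ℂ (i + 1)) * (genC ℂ q * genZ ℂ i * genZ ℂ (i + 1)) =
      toRF ℂ (C (q ^ 2) * X i ^ 2 - X (i + 1) ^ 2) := by
  have hz := genZ_ne_zero (K₀ := ℂ) i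
  have hz' := genZ_ne_zero (K₀ := ℂ) (i + 1)
  unfold qbr
  simp only [map_sub, map_mul, map_pow]
  change _ = genC ℂ q ^ 2 * genZ ℂ i ^ 2 - genZ ℂ (i + 1) ^ 2
  have hq : genC ℂ q ≠ 0 := toRF_ne_zero_of_eval (fun _ => 1) (by simp [hq0])
  field_simp

/-- **Pinning lemma**: for a primitive polynomial ground state `P`, an exchange relation at level
`i` with fibre map `g` (`E_Q = Σ_{g Q₀ = Q} P_{Q₀}`), scalar `c` satisfying the unitarity cocycle,
and left side vanishing on `z_{i+1} = q z_i`, the scalar is `c = [q z_i/z_{i+1}]`.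
[cite: IkhlefPonsaing2012, §3.4] -/
theorem exchange_scalar_pinned {q : ℂ} (hq : q ^ 2 + q + 1 = 0) {P : ColPattern m → MvPolynomial ℕ ℂ}
    (hprim : PolyPrimitive P)
    (hP : ∀ Q', ∑ Q, ipTransferMatrixW m (genC ℂ q) (genW ℂ) (genZ ℂ) Q Q' * toRF ℂ (P Q) = toRF ℂ (P Q'))
    (i : ℕ) (g : ColPattern m → ColPattern m) {c : RapidityField ℂ}
    (hc : ∀ Q, qbr (genC ℂ q * genZ ℂ (i + 1) / genZ ℂ i) * toRF ℂ (P Q) -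
        qbr (genZ ℂ i / genZ ℂ (i + 1)) * ∑ Q₀ ∈ Finset.univ.filter (fun Q₀ => g Q₀ = Q), toRF ℂ (P Q₀) =
      c * genSwap ℂ i (toRF ℂ (P Q)))
    (hcoc : c * genSwap ℂ i c =
      qbr (genC ℂ q / (genZ ℂ i / genZ ℂ (i + 1))) * qbr (genC ℂ q * (genZ ℂ i / genZ ℂ (i + 1))))
    (hvan : ∀ Q, substHom (i + 1) (C q * X i)
      ((C (q ^ 2) * X (i + 1) ^ 2 - X i ^ 2) * P Q -
        C q * (X i ^ 2 - X (i + 1) ^ 2) * ∑ Q₀ ∈ Finset.univ.filter (fun Q₀ => g Q₀ = Q), P Q₀) = 0) :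
    c = qbr (genC ℂ q * genZ ℂ i / genZ ℂ (i + 1)) := by
  classical
  have hq0 : q ≠ 0 := by rintro rfl; norm_num at hq
  set D : RapidityField ℂ := genC ℂ q * genZ ℂ i * genZ ℂ (i + 1) with hD
  have hcq : genC ℂ q ≠ 0 := toRF_ne_zero_of_eval (fun _ => 1) (by simp [hq0])
  have hD0 : D ≠ 0 := mul_ne_zero (mul_ne_zero hcq (genZ_ne_zero _)) (genZ_ne_zero _)
  set E : ColPattern m → MvPolynomial ℕ ℂ := fun Q => ∑ Q₀ ∈ Finset.univ.filter (fun Q₀ => g Q₀ = Q), P Q₀ with hE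
  -- polynomial form of the relation
  have hpoly : ∀ Q, toRF ℂ ((C (q ^ 2) * X (i + 1) ^ 2 - X i ^ 2) * P Q - C q * (X i ^ 2 - X (i + 1) ^ 2) * E Q) =
      (c * D) * toRF ℂ (rename (Equiv.swap i (i + 1)) (P Q)) := by
    intro Q
    have := congrArg (fun x => x * D) (hc Q)
    rw [sub_mul, mul_right_comm, qbr_mul_clear₁ hq0, mul_right_comm, qbr_mul_clear₂, genSwap_toRF] at this
    rw [map_sub, map_mul, map_mul, hE]
    simp only [map_sum]
    rw [this]; ring
  -- `c D` is a polynomial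
  have hprimσ : PolyPrimitive fun Q => rename (Equiv.swap i (i + 1)) (P Q) :=
    hprim.map_equiv (renameEquiv ℂ (Equiv.swap i (i + 1))).toRingEquiv
  obtain ⟨C₀, hC₀⟩ := hprimσ.exists_eq_toRF (c := c * D) fun Q => ⟨_, (hpoly Q).symm⟩
  -- apply the core
  obtain ⟨εi, hεi, hPi⟩ := primitive_fixed_parity hq hprim hP i
  obtain ⟨εi1, -, hPi1⟩ := primitive_fixed_parity hq hprim hP (i + 1)
  have hEpar : ∀ Q, substHom (i + 1) (-X (i + 1)) (E Q) = C εi1 * E Q := by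
    intro Q; rw [hE]; simp only [map_sum, hPi1, Finset.mul_sum]
  have hid : ∀ Q, (C (q ^ 2) * X (i + 1) ^ 2 - X i ^ 2) * P Q - C q * (X i ^ 2 - X (i + 1) ^ 2) * E Q =
      C₀ * rename (Equiv.swap i (i + 1)) (P Q) := fun Q =>
    toRF_injective (by rw [hpoly Q, hC₀, map_mul])
  have hcocP : C₀ * rename (Equiv.swap i (i + 1)) C₀ =
      (C (q ^ 2) * X (i + 1) ^ 2 - X i ^ 2) * (C (q ^ 2) * X i ^ 2 - X (i + 1) ^ 2) := by
    apply toRF_injective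
    have hσD : genSwap ℂ i D = D := by
      rw [hD, map_mul, map_mul, genSwap_genC, genSwap_genZ, genSwap_genZ, zswap_self, zswap_succ]; ring
    have := congrArg (fun x => x * (D * D)) hcoc
    rw [show c * genSwap ℂ i c * (D * D) = (c * D) * genSwap ℂ i (c * D) by rw [map_mul, hσD]; ring, hC₀,
      genSwap_toRF, ← map_mul, show qbr (genC ℂ q / (genZ ℂ i / genZ ℂ (i + 1))) * qbr (genC ℂ q * (genZ ℂ i / genZ ℂ (i + 1))) *
        (D * D) = (qbr (genC ℂ q * genZ ℂ (i + 1) / genZ ℂ i) * D) * (qbr (genC ℂ q * genZ ℂ i / genZ ℂ (i + 1)) * D) by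
        rw [div_div_eq_mul_div, mul_div_assoc]; ring, qbr_mul_clear₁ hq0, qbr_mul_clear₃ hq0, ← map_mul] at this
    exact this
  have hcore := pin_core (ι := ColPattern m) (by norm_num) hq0 (sq_ne_one_of_quad hq (by norm_num)) i hprim hεi hPi
    hPi1 hEpar hid hvan hcocP
  -- read off `c`
  have : c * D = qbr (genC ℂ q * genZ ℂ i / genZ ℂ (i + 1)) * D := by rw [hC₀, hcore, qbr_mul_clear₃ hq0]
  exact mul_right_cancel₀ hD0 this

/-- **The odd exchange scalars of a primitive polynomial ground state are pinned**:
`c_{2j'+1} = [q z_i/z_{i+1}]`, given the vanishing of the exchange numerator on `H_i`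
(supplied by Lemma A: `DiagonalStripHyperplaneRecursion`). [cite: IkhlefPonsaing2012, §3.4] -/
theorem groundState_exchange_odd_exact {q : ℂ} (hq : q ^ 2 + q + 1 = 0) {P : ColPattern m → MvPolynomial ℕ ℂ}
    (hprim : PolyPrimitive P)
    (hP : ∀ Q', ∑ Q, ipTransferMatrixW m (genC ℂ q) (genW ℂ) (genZ ℂ) Q Q' * toRF ℂ (P Q) = toRF ℂ (P Q'))
    (j' : Fin m)
    (hvan : ∀ Q, substHom (2 * (j' : ℕ) + 1 + 1) (C q * X (2 * (j' : ℕ) + 1))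
      ((C (q ^ 2) * X (2 * (j' : ℕ) + 1 + 1) ^ 2 - X (2 * (j' : ℕ) + 1) ^ 2) * P Q -
        C q * (X (2 * (j' : ℕ) + 1) ^ 2 - X (2 * (j' : ℕ) + 1 + 1) ^ 2) *
          ∑ Q₀ ∈ Finset.univ.filter (fun Q₀ => lump (cpJoin (Fin.castSucc j') j'.succ Q₀) = Q), P Q₀) = 0) :
    ∀ Q, qbr (genC ℂ q * genZ ℂ (2 * (j' : ℕ) + 1 + 1) / genZ ℂ (2 * (j' : ℕ) + 1)) * toRF ℂ (P Q) -
        qbr (genZ ℂ (2 * (j' : ℕ) + 1) / genZ ℂ (2 * (j' : ℕ) + 1 + 1)) *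
          ∑ Q₀ ∈ Finset.univ.filter (fun Q₀ => lump (cpJoin (Fin.castSucc j') j'.succ Q₀) = Q), toRF ℂ (P Q₀) =
      qbr (genC ℂ q * genZ ℂ (2 * (j' : ℕ) + 1) / genZ ℂ (2 * (j' : ℕ) + 1 + 1)) * genSwap ℂ (2 * (j' : ℕ) + 1) (toRF ℂ (P Q)) := by
  classical
  have hP0 : (fun Q => toRF ℂ (P Q)) ≠ 0 := by
    obtain ⟨Q₀, hQ₀⟩ := hprim.exists_ne_zero
    intro h; exact hQ₀ (toRF_injective ((congrFun h Q₀).trans (map_zero _).symm))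
  obtain ⟨c, hc⟩ := groundState_exchange_odd_upToScalar hq hP hP0 (Fin.castSucc j') j'.succ (by simp)
  simp only [Fin.val_castSucc] at hc
  -- the cocycle, through the connectivity basis
  have hcNC : ∀ s : NCState (m + 1),
      (tlRnum (genC ℂ q) (genZ ℂ (2 * (j' : ℕ) + 1) / genZ ℂ (2 * (j' : ℕ) + 2))
          (tlConn m (RapidityField ℂ) ⟨2 * (j' : ℕ), by omega⟩) (ncFinsupp (ncVec fun Q => toRF ℂ (P Q)))) s =
        c * genSwap ℂ (2 * (j' : ℕ) + 1) (ncVec (fun Q => toRF ℂ (P Q)) s) := by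
    intro s
    rw [tlRnum_tlConn_apply, tlConnFun_two_mul, div_div_eq_mul_div]
    simp only [ncFinsupp_apply]
    rw [← sum_fiber_cpJoin_eq (fun Q h => groundState_support hq hP h) (Fin.castSucc j') j'.succ (by simp) s]
    exact hc (cpOf s)
  have hcoc := ncGroundState_exchange_scalar_cocycle_odd hq hP hP0 j' hcNC
  have hpin := exchange_scalar_pinned hq hprim hP (2 * (j' : ℕ) + 1) (fun Q₀ => lump (cpJoin (Fin.castSucc j') j'.succ Q₀))
    (c := c) (by simpa [map_sum] using hc) hcoc hvan
  intro Q
  rw [← hpin]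
  exact hc Q

/-- **The even exchange scalars are pinned**: `c_{2b} = [q z_i/z_{i+1}]` (`b = b₀ + 1`), given the
vanishing of the exchange numerator on `H_i`. [cite: IkhlefPonsaing2012, §3.4] -/
theorem groundState_exchange_even_exact {q : ℂ} (hq : q ^ 2 + q + 1 = 0) {P : ColPattern m → MvPolynomial ℕ ℂ}
    (hprim : PolyPrimitive P)
    (hP : ∀ Q', ∑ Q, ipTransferMatrixW m (genC ℂ q) (genW ℂ) (genZ ℂ) Q Q' * toRF ℂ (P Q) = toRF ℂ (P Q'))
    (b0 : Fin m)
    (hvan : ∀ Q, substHom (2 * (b0 : ℕ) + 2 + 1) (C q * X (2 * (b0 : ℕ) + 2))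
      ((C (q ^ 2) * X (2 * (b0 : ℕ) + 2 + 1) ^ 2 - X (2 * (b0 : ℕ) + 2) ^ 2) * P Q -
        C q * (X (2 * (b0 : ℕ) + 2) ^ 2 - X (2 * (b0 : ℕ) + 2 + 1) ^ 2) *
          ∑ Q₀ ∈ Finset.univ.filter (fun Q₀ => lump (cpIsolate b0.succ Q₀) = Q), P Q₀) = 0) :
    ∀ Q, qbr (genC ℂ q * genZ ℂ (2 * (b0 : ℕ) + 2 + 1) / genZ ℂ (2 * (b0 : ℕ) + 2)) * toRF ℂ (P Q) -
        qbr (genZ ℂ (2 * (b0 : ℕ) + 2) / genZ ℂ (2 * (b0 : ℕ) + 2 + 1)) *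
          ∑ Q₀ ∈ Finset.univ.filter (fun Q₀ => lump (cpIsolate b0.succ Q₀) = Q), toRF ℂ (P Q₀) =
      qbr (genC ℂ q * genZ ℂ (2 * (b0 : ℕ) + 2) / genZ ℂ (2 * (b0 : ℕ) + 2 + 1)) * genSwap ℂ (2 * (b0 : ℕ) + 2) (toRF ℂ (P Q)) := by
  classical
  have hP0 : (fun Q => toRF ℂ (P Q)) ≠ 0 := by
    obtain ⟨Q₀, hQ₀⟩ := hprim.exists_ne_zero
    intro h; exact hQ₀ (toRF_injective ((congrFun h Q₀).trans (map_zero _).symm))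
  obtain ⟨c, hc⟩ := groundState_exchange_even_upToScalar hq hP hP0 (Fin.castSucc b0) b0.succ (by simp)
  simp only [Fin.val_succ] at hc
  have e1 : 2 * ((b0 : ℕ) + 1) = 2 * (b0 : ℕ) + 2 := by ring
  rw [e1] at hc
  have hcNC : ∀ s : NCState (m + 1),
      (tlRnum (genC ℂ q) (genZ ℂ (2 * (b0 : ℕ) + 2) / genZ ℂ (2 * (b0 : ℕ) + 3))
          (tlConn m (RapidityField ℂ) ⟨2 * (b0 : ℕ) + 1, by omega⟩) (ncFinsupp (ncVec fun Q => toRF ℂ (P Q)))) s =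
        c * genSwap ℂ (2 * (b0 : ℕ) + 2) (ncVec (fun Q => toRF ℂ (P Q)) s) := by
    intro s
    rw [tlRnum_tlConn_apply, tlConnFun_two_mul_add_one, div_div_eq_mul_div]
    simp only [ncFinsupp_apply]
    rw [← sum_fiber_cpIsolate_eq (fun Q h => groundState_support hq hP h) (Fin.succ_ne_zero b0) s]
    exact hc (cpOf s)
  have hcoc := ncGroundState_exchange_scalar_cocycle_even hq hP hP0 b0 hcNC
  have hpin := exchange_scalar_pinned hq hprim hP (2 * (b0 : ℕ) + 2) (fun Q₀ => lump (cpIsolate b0.succ Q₀))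
    (c := c) (by simpa [map_sum] using hc) hcoc hvan
  intro Q
  rw [← hpin]
  exact hc Q

end ExchangePinning

/-! ### Pinning the top reflection scalar -/

section ReflectionPinning

open MvPolynomial

variable {K₀ : Type*} [Field K₀] {m : ℕ}

/-- Setting `X_L = 1` ignores the reversal of `X_L`-exponents. [folklore] -/
theorem substHom_one_revPoly (L N : ℕ) (f : MvPolynomial ℕ K₀) :
    substHom L 1 (revPoly L N f) = substHom L 1 f := by
  classical
  conv_rhs => rw [f.as_sum]
  rw [revPoly, map_sum, map_sum]
  refine Finset.sum_congr rfl fun e _ => ?_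
  simp only [substHom, aeval_monomial]
  congr 1
  have hs : e.support ⊆ insert L e.support := Finset.subset_insert _ _
  rw [Finsupp.prod_of_support_subset e hs _ (fun i _ => pow_zero _),
    Finsupp.prod_of_support_subset _ (support_revExp_subset L N e) _ (fun i _ => pow_zero _)]
  refine Finset.prod_congr rfl fun n _ => ?_
  by_cases h : n = L
  · subst h; simp
  · rw [Function.update_of_ne h, revExp_apply_of_ne _ h]

/-- The sign flip commutes with the inversion substitution. [folklore] -/
theorem genFlip_invSubst (k : ℕ) (f : MvPolynomial ℕ K₀) :
    genFlip K₀ k (invSubst K₀ k f) = invSubst K₀ k (substHom k (-X k) f) := by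
  have : (genFlip K₀ k).toRingHom.comp (invSubst K₀ k) = (invSubst K₀ k).comp (substHom k (-X k)).toRingHom := by
    refine ringHom_ext (fun a => ?_) (fun n => ?_)
    · simp only [RingHom.comp_apply, invSubst, eval₂Hom_C, RingEquiv.toRingHom_eq_coe, RingHom.coe_coe,
        AlgHom.toRingHom_eq_coe, substHom_C]
      exact genFlip_genC k a
    · simp only [RingHom.comp_apply, RingEquiv.toRingHom_eq_coe, RingHom.coe_coe, AlgHom.toRingHom_eq_coe]
      rw [invSubst, eval₂Hom_X']
      by_cases h : n = k
      · subst h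
        rw [if_pos rfl, substHom_X_self, map_neg, eval₂Hom_X', if_pos rfl, map_inv₀, genFlip_genZ, if_pos rfl, inv_neg]
      · rw [if_neg h, substHom_X_of_ne _ h, eval₂Hom_X', if_neg h, genFlip_genZ, if_neg h]
  exact RingHom.congr_fun this f

/-- **The sign flip `genFlip L` commutes with the inversion `genInv L`.** [folklore] -/
theorem genFlip_genInv (k : ℕ) (x : RapidityField K₀) : genFlip K₀ k (genInv K₀ k x) = genInv K₀ k (genFlip K₀ k x) := by
  have : (genFlip K₀ k).toRingHom.comp (genInv K₀ k) = (genInv K₀ k).comp (genFlip K₀ k).toRingHom := by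
    refine IsLocalization.ringHom_ext (nonZeroDivisors (MvPolynomial ℕ K₀)) (RingHom.ext fun f => ?_)
    simp only [RingHom.comp_apply, RingEquiv.toRingHom_eq_coe, RingHom.coe_coe]
    change genFlip K₀ k (genInv K₀ k (toRF K₀ f)) = genInv K₀ k (genFlip K₀ k (toRF K₀ f))
    rw [genInv_toRF, genFlip_toRF, genInv_toRF, genFlip_invSubst]
  exact RingHom.congr_fun this x

/-- **The top reflection scalar of a primitive polynomial ground state is an even power of `z_L`**:
`Ψ(…, 1/z_L) = z_L^{2a} Ψ(…, z_L)`. [cite: IkhlefPonsaing2012, §3.4] -/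
theorem groundState_reflect_top_zpow {q : ℂ} (hq : q ^ 2 + q + 1 = 0) {P : ColPattern m → MvPolynomial ℕ ℂ}
    (hprim : PolyPrimitive P)
    (hP : ∀ Q', ∑ Q, ipTransferMatrixW m (genC ℂ q) (genW ℂ) (genZ ℂ) Q Q' * toRF ℂ (P Q) = toRF ℂ (P Q')) :
    ∃ a : ℤ, ∀ Q, genInv ℂ (2 * m + 1) (toRF ℂ (P Q)) = genZ ℂ (2 * m + 1) ^ (2 * a) * toRF ℂ (P Q) := by
  classical
  have hP0 : (fun Q => toRF ℂ (P Q)) ≠ 0 := by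
    obtain ⟨Q₀, hQ₀⟩ := hprim.exists_ne_zero
    intro h; exact hQ₀ (toRF_injective ((congrFun h Q₀).trans (map_zero _).symm))
  obtain ⟨-, d, hd, hdd⟩ := groundState_reflect_scalar_cocycle hq hP hP0
  have hz : genZ ℂ (2 * m + 1) ≠ 0 := genZ_ne_zero (2 * m + 1)
  -- a common bound on the `X_L`-degrees
  set N := Finset.univ.sup fun Q => (P Q).degreeOf (2 * m + 1) with hN
  have hNQ : ∀ Q, (P Q).degreeOf (2 * m + 1) ≤ N := fun Q => Finset.le_sup (f := fun Q => (P Q).degreeOf (2 * m + 1)) (Finset.mem_univ Q)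
  -- `d z_L^N` is a polynomial `D₀`
  have hrev : ∀ Q, (d * genZ ℂ (2 * m + 1) ^ N) * toRF ℂ (P Q) = toRF ℂ (revPoly (2 * m + 1) N (P Q)) := by
    intro Q
    rw [← invSubst_mul_pow_eq (2 * m + 1) N (P Q) (hNQ Q), ← genInv_toRF, hd Q]; ring
  obtain ⟨D₀, hD₀⟩ := hprim.exists_eq_toRF (c := d * genZ ℂ (2 * m + 1) ^ N) fun Q => ⟨_, hrev Q⟩
  have hD₀0 : D₀ ≠ 0 := by
    rintro rfl
    rw [map_zero, mul_eq_zero] at hD₀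
    rcases hD₀ with h | h
    · rw [h, zero_mul] at hdd; exact zero_ne_one hdd
    · exact pow_ne_zero _ hz h
  -- the cocycle: `D₀ · revPoly D₀ = X_L^M`
  set M := D₀.degreeOf (2 * m + 1) with hM
  have hcocP : D₀ * revPoly (2 * m + 1) M D₀ = X (2 * m + 1) ^ M := by
    apply toRF_injective
    have h1 : toRF ℂ D₀ * invSubst ℂ (2 * m + 1) D₀ = 1 := by
      have := hdd
      rw [show d = toRF ℂ D₀ / genZ ℂ (2 * m + 1) ^ N by rw [← hD₀, mul_div_cancel_right₀ _ (pow_ne_zero _ hz)], map_div₀,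
        map_pow, genInv_toRF, genInv_genZ, Function.update_self] at this
      rw [inv_pow, div_inv_eq_mul, div_mul_eq_mul_div, mul_div_assoc, mul_div_cancel_right₀ _ (pow_ne_zero _ hz)] at this
      exact this
    rw [map_mul, ← invSubst_mul_pow_eq (2 * m + 1) M D₀ le_rfl, ← mul_assoc, h1, one_mul, map_pow]; rfl
  obtain ⟨k, -, hk⟩ := (dvd_prime_pow (MvPolynomial.X_prime (R := ℂ) (σ := ℕ) (i := (2 * m + 1))) M).1 ⟨_, hcocP.symm⟩
  obtain ⟨u, hu⟩ := hk.symm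
  obtain ⟨u₀, hu₀0, hu₀⟩ := (MvPolynomial.isUnit_iff_eq_C_of_isReduced).1 u.isUnit
  have hD₀eq : D₀ = C u₀ * X (2 * m + 1) ^ k := by rw [← hu, hu₀]; ring
  -- the sign: `u₀ = 1`, by setting `X_L = 1`
  have hpolyQ : ∀ Q, D₀ * P Q = revPoly (2 * m + 1) N (P Q) := fun Q => toRF_injective (by rw [map_mul, ← hD₀, hrev Q])
  have hu₀1 : u₀ = 1 := by
    by_contra hne
    refine not_isUnit_X_sub_C (2 * m + 1) (1 : ℂ) (hprim _ fun Q => ?_)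
    rw [C_1]
    apply X_sub_dvd_of_substHom_eq_zero
    have h1 := congrArg (substHom (2 * m + 1) 1) (hpolyQ Q)
    rw [substHom_one_revPoly, map_mul, hD₀eq, map_mul, map_pow, substHom_C, substHom_X_self, one_pow, mul_one] at h1
    have h2 : C (u₀ - 1) * substHom (2 * m + 1) 1 (P Q) = 0 := by rw [map_sub, C_1, sub_mul, one_mul, h1, sub_self]
    exact (mul_eq_zero.1 h2).resolve_left (by rw [C_eq_zero, sub_eq_zero]; exact hne)
  rw [hu₀1, C_1, one_mul] at hD₀eq
  -- `d = z_L^k / z_L^N`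
  have hdval : d = genZ ℂ (2 * m + 1) ^ k / genZ ℂ (2 * m + 1) ^ N := by
    rw [eq_div_iff (pow_ne_zero _ hz), hD₀, hD₀eq, map_pow]; rfl
  -- parity: `k + N` is even
  obtain ⟨ε, hε, hPε⟩ := primitive_fixed_parity hq hprim hP (2 * m + 1)
  obtain ⟨Q₀, hQ₀⟩ := hprim.exists_ne_zero
  have hflipd : genFlip ℂ (2 * m + 1) d = d := by
    have h1 := congrArg (genFlip ℂ (2 * m + 1)) (hd Q₀)
    rw [genFlip_genInv, genFlip_toRF, hPε, map_mul (toRF ℂ), map_mul (genInv ℂ (2 * m + 1))] at h1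
    rw [map_mul (genFlip ℂ (2 * m + 1)), genFlip_toRF, hPε, map_mul (toRF ℂ)] at h1
    change genInv ℂ (2 * m + 1) (genC ℂ ε) * _ = _ * (genC ℂ ε * _) at h1
    rw [genInv_genC, hd Q₀] at h1
    have hε0 : genC ℂ ε ≠ 0 := by
      refine toRF_ne_zero_of_eval (fun _ => 1) ?_
      simp only [eval_C]; rintro rfl; norm_num at hε
    have hQ₀' : toRF ℂ (P Q₀) ≠ 0 := fun h => hQ₀ (toRF_injective (h.trans (map_zero _).symm))
    have h2 : (genFlip ℂ (2 * m + 1) d - d) * (genC ℂ ε * toRF ℂ (P Q₀)) = 0 := by linear_combination -h1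
    exact sub_eq_zero.1 ((mul_eq_zero.1 h2).resolve_right (mul_ne_zero hε0 hQ₀'))
  have heven : Even (k + N) := by
    rw [hdval, map_div₀, map_pow, map_pow, genFlip_genZ, if_pos rfl, neg_pow, neg_pow (genZ ℂ (2 * m + 1)),
      div_eq_div_iff (mul_ne_zero (pow_ne_zero _ (by norm_num)) (pow_ne_zero _ hz)) (pow_ne_zero _ hz)] at hflipd
    -- (-1)^k z^k z^N = z^k (-1)^N z^N
    have h1 : ((-1 : RapidityField ℂ) ^ k - (-1) ^ N) * (genZ ℂ (2 * m + 1) ^ k * genZ ℂ (2 * m + 1) ^ N) = 0 := by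
      linear_combination hflipd
    have h2 : (-1 : RapidityField ℂ) ^ k = (-1) ^ N :=
      sub_eq_zero.1 ((mul_eq_zero.1 h1).resolve_right (mul_ne_zero (pow_ne_zero _ hz) (pow_ne_zero _ hz)))
    have h3 : (-1 : RapidityField ℂ) ^ (k + N) = 1 := by rw [pow_add, h2, ← pow_add, ← two_mul, pow_mul, neg_one_sq, one_pow]
    exact (neg_one_pow_eq_one_iff_even (R := RapidityField ℂ) (by norm_num)).1 h3
  obtain ⟨a, ha⟩ : ∃ a : ℤ, (k : ℤ) - N = 2 * a := by
    obtain ⟨r, hr⟩ := heven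
    exact ⟨(k : ℤ) - r, by omega⟩
  refine ⟨a, fun Q => ?_⟩
  rw [hd Q, hdval, ← ha, zpow_sub₀ hz, zpow_natCast, zpow_natCast]

end ReflectionPinning

end Literature.Probability.Percolation
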